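import Summits.QuantumFields.YangMills.Theorems.BalabanUVNodesN08HaarCompatibilityGuardJacobian
import Mathlib.Analysis.Calculus.MeanValue

/-!
# BalabanUVNodes ∕ N08 — geodesics of the unit quaternions for the guard analysis: chord ↔ angle, the norm of the left-trivialised log differential
# `‖N_w x‖ ≤ (θ∕sin θ)‖x‖`, `exp` is 1-Lipschitz on `Im ℍ`, and GEODESIC CONVEXITY OF CHORDAL BALLS (slerp)

WIDTH SEAT `pub-ymgap-dag-n08-w3` g5, `W-SEAT-START-LIST.md` §0 (iii); item-3 lineage part 26A = the [folklore] toolkit of part 26B `…GuardCoreInjective`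
(global injectivity of the printed exp-mean-log fibre map on its guard set), 2026-08-28.  DAG node N08 = [Balaban1985UV3] Thm 1 p. 257 + Thm 2 p. 272;
[Balaban1987RG1] (0.4) p. 253; key item K1⁷ `StabilityBAtRecordR13SepCoPH` (stmt-QuantumFields-20542, `aside`), `--supports … --as helper`.  COUNT-NEUTRAL.

WHAT THIS FILE PROVES (theorems only, 0 def; [folklore] calculus on `ℍ` over pub-balaban's quaternion model `T4QuatExpLog` — `qlog`, `N`, `par`, `perp`,
`fderiv_exp_apply_of_commute` ∕ `…_of_inner_eq_zero` BY IMPORT; nothing of Bałaban's asserted):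
 * `norm_mul_star_sub_one` (`‖aū − 1‖ = ‖a − u‖`), `re_mul_mul_star`, `inner_self_mul_left`, `inner_left_mul_self`, `inner_mul_left_mul_left` — unit-quaternion
   algebra (the one-liners `re(ab) = re(ba)`, `ūu = 1`, `⟨↑r, q⟩ = r·re q` are inlined: they exist elsewhere in the tree);
 * `norm_exp_sub_one_eq` (**`‖eˣ − 1‖ = 2|sin(‖X‖∕2)|`**, imaginary `X`), `norm_sub_one_eq_two_mul_sin` (unit `W`, `‖W − 1‖ ≤ 3∕4`: `‖qlog W‖ ≤ 3` and
   `‖W − 1‖ = 2 sin(‖qlog W‖∕2)`), `norm_qlog_lt_of_chord` (`‖W − 1‖ < δ ≤ sin θ`, `0 < θ ≤ 3∕8` ⇒ `‖qlog W‖ < θ`);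
 * ★ `sin_mul_norm_N_le` ∕ `norm_N_le`: **`‖N_w x‖ ≤ (θ∕sin θ)·‖x‖`** (`θ = ‖w‖ < π`; `‖N_w x‖² = ‖x_∥‖² + (θ∕sin θ)²‖x_⊥‖²`, `(θ cot θ)² + θ² = θ²∕sin²θ`), monotone in `θ`
   via part 14's `sin_div_le_sin_div`;
 * ★ `norm_fderiv_exp_apply_le`: **`‖D exp(w) h‖ ≤ ‖h‖`** for imaginary `w, h` (`D exp(w)h_∥ = h_∥e^w`, `D exp(w)h_⊥ = sinc‖w‖·h_⊥`, orthogonal images);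
   `norm_exp_sub_exp_le`: **`‖eᵃ − eᵇ‖ ≤ ‖a − b‖` on `Im ℍ`** (mean-value inequality along the imaginary segment);
 * `exp_smul_of_re_eq_zero` (`e^{tx} = cos(t‖x‖) + (sin(t‖x‖)∕‖x‖)x`), `slerp_identity`, `sinusoid_ge_of_endpoints` (a sinusoid of frequency `θ < π` is `≥ min` of
   its values at `0, 1` on `[0,1]` when these are `≥ 0`), ★ `norm_sub_mul_exp_smul_le` ∕ `norm_sub_mul_exp_smul_lt`: **GEODESIC CONVEXITY OF CHORDAL BALLS
   ON `S³`** — `‖a − u e^{tx}‖ < δ` on `t ∈ [0,1]` if it holds at `t = 0, 1` (`δ ≤ 1`, `‖x‖ < π`); so the guard set `{u : ∀ i ‖aᵢ − u‖ < δ}` contains the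
   geodesic between any two of its points.
HONEST FRAMING: toolkit only; (H_K) NOT discharged; E6′ NOT decided; count-neutral; N08 NOT discharged; counts unmoved (typed 28∕28 · discharged 5∕27);
R4 closes the CONDITIONAL rung `BalabanLadder.UV` only; the Yang–Mills mass gap (Clay) is NOT proved; nothing continuum ∕ OS.  0 `sorry`, standard axioms.
-/

noncomputable section

open NormedSpace Set Metric Function Filter
open scoped RealInnerProductSpace Topology Quaternion

namespace Summit.QuantumFields.YangMills.BalabanUVNodes.N08HaarCompatibilityGuardGeodesics

open Literature.MathematicalPhysics.QuantumFieldTheory.Balaban1983to89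
open Literature.MathematicalPhysics.QuantumFieldTheory.Balaban1983to89.T4QuatExpLog
open Literature.MathematicalPhysics.QuantumFieldTheory.Balaban1983to89.T4EMLFibreAC

/-! ## §1 Quaternion trigonometry on the unit sphere [folklore] -/

section Trig

/-- For a unit `u`: `‖a ū − 1‖ = ‖a − u‖` (right-multiply by `u`). [folklore] -/
theorem norm_mul_star_sub_one {a u : ℍ} (hu : ‖u‖ = 1) : ‖a * star u - 1‖ = ‖a - u‖ := by
  have hsu : star u * u = 1 := by rw [Quaternion.star_mul_self, Quaternion.normSq_eq_norm_mul_self, hu]; simp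
  have h : (a * star u - 1) * u = a - u := by rw [sub_mul, mul_assoc, hsu, mul_one, one_mul]
  rw [← h, norm_mul, hu, mul_one]

/-- `w x w̄` is imaginary for imaginary `x`. [folklore] -/
theorem re_mul_mul_star (w : ℍ) {x : ℍ} (hx : x.re = 0) : (w * x * star w).re = 0 := by
  apply Quaternion.star_eq_neg.1
  rw [star_mul, star_mul, star_star, Quaternion.star_eq_neg.2 hx]
  simp [mul_assoc]

/-- THE CHORD OF AN ANGLE: `‖e^X − 1‖ = 2|sin(‖X‖∕2)|` for imaginary `X` (`e^X = cos θ + (sin θ∕θ) X`, `‖e^X − 1‖² = 2 − 2cos θ`). [folklore] -/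
theorem norm_exp_sub_one_eq {X : ℍ} (hX : X.re = 0) : ‖exp X - 1‖ = 2 * |Real.sin (‖X‖ / 2)| := by
  have h1 : ⟪exp X, (1 : ℍ)⟫ = Real.cos ‖X‖ := by
    rw [Quaternion.inner_def, star_one, mul_one, exp_re_of_re_eq_zero hX]
  have hsq : ‖exp X - 1‖ ^ 2 = (2 * |Real.sin (‖X‖ / 2)|) ^ 2 := by
    rw [norm_sub_sq_real, norm_exp_of_re_eq_zero hX, h1, norm_one, mul_pow, sq_abs]
    have hc : Real.cos ‖X‖ = 1 - 2 * Real.sin (‖X‖ / 2) ^ 2 := by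
      have := Real.cos_sq (‖X‖ / 2)
      rw [show 2 * (‖X‖ / 2) = ‖X‖ by ring] at this
      nlinarith [Real.sin_sq_add_cos_sq (‖X‖ / 2)]
    rw [hc]; ring
  have h0 : 0 ≤ 2 * |Real.sin (‖X‖ / 2)| := by positivity
  exact (pow_left_inj₀ (norm_nonneg _) h0 two_ne_zero).1 hsq

/-- For a UNIT quaternion `W` with `‖W − 1‖ ≤ 3∕4`: its logarithm is an angle `θ_W = ‖qlog W‖ < 3 < π` with `‖W − 1‖ = 2 sin(θ_W∕2)`. [folklore] -/
theorem norm_sub_one_eq_two_mul_sin {W : ℍ} (hW1 : ‖W‖ = 1) (hW : ‖W - 1‖ ≤ 3 / 4) :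
    ‖qlog W‖ ≤ 3 ∧ ‖W - 1‖ = 2 * Real.sin (‖qlog W‖ / 2) := by
  have hW' : ‖W - 1‖ < 1 := lt_of_le_of_lt hW (by norm_num)
  have hθ : ‖qlog W‖ ≤ 3 := by
    refine (norm_qlog_le hW').trans ?_
    rw [div_le_iff₀ (by linarith)]
    linarith
  refine ⟨hθ, ?_⟩
  have h := norm_exp_sub_one_eq (qlog_re_of_norm_eq_one hW1 hW')
  rw [exp_qlog hW'] at h
  rw [h, abs_of_nonneg]
  exact Real.sin_nonneg_of_nonneg_of_le_pi (by positivity) (by linarith [Real.pi_gt_three])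

/-- ANGLE COMPARISON THROUGH THE CHORD: for a unit `W` with `‖W − 1‖ < δ ≤ sin θ`, `0 < θ ≤ 3∕8`: `‖qlog W‖ < θ`. [folklore] -/
theorem norm_qlog_lt_of_chord {W : ℍ} {δ θ : ℝ} (hW1 : ‖W‖ = 1) (hWδ : ‖W - 1‖ < δ) (hδ : δ ≤ Real.sin θ) (hθ0 : 0 < θ)
    (hθ : θ ≤ 3 / 8) : ‖qlog W‖ < θ := by
  have hδθ : δ ≤ θ := hδ.trans (Real.sin_le hθ0.le)
  obtain ⟨h3, hch⟩ := norm_sub_one_eq_two_mul_sin hW1 (by linarith)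
  -- `2 sin(θ_W/2) < sin θ ≤ 2 sin(θ/2)`
  have hs2 : Real.sin θ ≤ 2 * Real.sin (θ / 2) := by
    have h := Real.sin_two_mul (θ / 2)
    rw [show 2 * (θ / 2) = θ by ring] at h
    rw [h]
    have hs : 0 ≤ Real.sin (θ / 2) := Real.sin_nonneg_of_nonneg_of_le_pi (by positivity) (by linarith [Real.pi_gt_three])
    nlinarith [Real.cos_le_one (θ / 2)]
  have hlt : Real.sin (‖qlog W‖ / 2) < Real.sin (θ / 2) := by linarith
  by_contra hle
  have hle : θ ≤ ‖qlog W‖ := not_lt.1 hle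
  have : Real.sin (θ / 2) ≤ Real.sin (‖qlog W‖ / 2) :=
    Real.sin_le_sin_of_le_of_le_pi_div_two (by linarith [Real.pi_gt_three]) (by linarith [Real.pi_gt_three]) (by linarith)
  linarith


/-- `⟨p, w p⟩ = 0` for imaginary `w` (`p p̄ = |p|²` is real). [folklore] -/
theorem inner_self_mul_left {w p : ℍ} (hw : w.re = 0) : ⟪p, w * p⟫ = 0 := by
  rw [Quaternion.inner_def, star_mul, ← mul_assoc, Quaternion.self_mul_star, Quaternion.coe_mul_eq_smul, Quaternion.re_smul,
    Quaternion.re_star, hw, smul_zero]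

/-- `⟨w, w p⟩ = 0` for imaginary `p` (`re(w p̄ w̄) = re(p̄ w̄ w) = |w|² re p̄`). [folklore] -/
theorem inner_left_mul_self {w p : ℍ} (hp : p.re = 0) : ⟪w, w * p⟫ = 0 := by
  have rmc : ∀ a b : ℍ, (a * b).re = (b * a).re := fun a b => by simp only [Quaternion.re_mul]; ring
  rw [Quaternion.inner_def, star_mul, ← mul_assoc, rmc, ← mul_assoc, Quaternion.star_mul_self, Quaternion.coe_mul_eq_smul,
    Quaternion.re_smul, Quaternion.re_star, hp, smul_zero]

/-- THE NORM OF THE LEFT-TRIVIALISED LOG DIFFERENTIAL: `sin θ · ‖N_w x‖ ≤ θ · ‖x‖`, `θ = ‖w‖ < π`, for imaginary `w, x` — i.e.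
`‖N_w x‖ ≤ (θ∕sin θ)‖x‖`; indeed `‖N_w x‖² = ‖x_∥‖² + (θ∕sin θ)²‖x_⊥‖²` (`x_∥ ⊥ θ cot θ·x_⊥ + w x_⊥`, `(θ cot θ)² + θ² = θ²∕sin²θ`). [folklore] -/
theorem sin_mul_norm_N_le {w x : ℍ} (hw : w.re = 0) (hx : x.re = 0) (hwπ : ‖w‖ < Real.pi) :
    Real.sin ‖w‖ * ‖N w x‖ ≤ ‖w‖ * ‖x‖ := by
  rcases eq_or_ne w 0 with rfl | hw0
  · simp
  have hθ : 0 < ‖w‖ := norm_pos_iff.2 hw0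
  have hsin : 0 < Real.sin ‖w‖ := Real.sin_pos_of_pos_of_lt_pi hθ hwπ
  set θ := ‖w‖ with hθ_def
  set p := perp w x with hp_def
  set q : ℍ := (1 - ψ θ) • p + w * p with hq_def
  have hp_re : p.re = 0 := perp_re hw hx
  have hN : N w x = par w x + q := by rw [N, hq_def, ← hθ_def, add_assoc]
  -- `‖q‖² = (θ/sin θ)² ‖p‖²`
  have h1ψ : 1 - ψ θ = θ * Real.cos θ / Real.sin θ := by rw [ψ_of_ne_zero hθ.ne']; ring
  have hq : ‖q‖ ^ 2 = (θ / Real.sin θ) ^ 2 * ‖p‖ ^ 2 := by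
    rw [hq_def, norm_add_sq_real, real_inner_smul_left, inner_self_mul_left hw, mul_zero, mul_zero, add_zero, norm_smul, norm_mul,
      ← hθ_def, mul_pow, mul_pow, Real.norm_eq_abs, sq_abs, h1ψ]
    field_simp
    have := Real.sin_sq_add_cos_sq θ
    ring_nf
    nlinarith [this]
  -- orthogonality `par ⊥ q`, `par ⊥ p`
  have hwp : ⟪w, p⟫ = 0 := by rw [hp_def]; exact inner_perp w x
  have hparq : ⟪par w x, q⟫ = 0 := by
    rw [par, real_inner_smul_left, hq_def, inner_add_right, inner_smul_right, hwp, mul_zero, zero_add,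
      inner_left_mul_self hp_re, mul_zero]
  have hparp : ⟪par w x, p⟫ = 0 := by rw [par, real_inner_smul_left, hwp, mul_zero]
  have hNsq : ‖N w x‖ ^ 2 = ‖par w x‖ ^ 2 + (θ / Real.sin θ) ^ 2 * ‖p‖ ^ 2 := by
    rw [hN, norm_add_sq_real, hparq, hq]; ring
  have hxsq : ‖x‖ ^ 2 = ‖par w x‖ ^ 2 + ‖p‖ ^ 2 := by
    conv_lhs => rw [← par_add_perp w x]
    rw [norm_add_sq_real, ← hp_def, hparp]; ring
  -- compare
  have hsinθ : Real.sin θ ≤ θ := Real.sin_le hθ.le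
  have hkey : (Real.sin θ * ‖N w x‖) ^ 2 ≤ (θ * ‖x‖) ^ 2 := by
    rw [mul_pow, mul_pow, hNsq, hxsq, mul_add, mul_add]
    have h1 : Real.sin θ ^ 2 * ‖par w x‖ ^ 2 ≤ θ ^ 2 * ‖par w x‖ ^ 2 :=
      mul_le_mul_of_nonneg_right (pow_le_pow_left₀ hsin.le hsinθ 2) (sq_nonneg _)
    have h2 : Real.sin θ ^ 2 * ((θ / Real.sin θ) ^ 2 * ‖p‖ ^ 2) = θ ^ 2 * ‖p‖ ^ 2 := by
      field_simp
    rw [h2]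
    linarith
  exact (pow_le_pow_iff_left₀ (by positivity) (by positivity) two_ne_zero).1 hkey

/-- Corollary: `‖N_w x‖ ≤ (ρ∕sin ρ)·‖x‖` whenever `‖w‖ ≤ ρ < π` (the factor `θ∕sin θ` is increasing). [folklore] -/
theorem norm_N_le {w x : ℍ} {ρ : ℝ} (hw : w.re = 0) (hx : x.re = 0) (hwρ : ‖w‖ ≤ ρ) (hρ0 : 0 < ρ) (hρπ : ρ < Real.pi) :
    ‖N w x‖ ≤ ρ / Real.sin ρ * ‖x‖ := by
  have hsinρ : 0 < Real.sin ρ := Real.sin_pos_of_pos_of_lt_pi hρ0 hρπ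
  rcases eq_or_ne w 0 with rfl | hw0
  · rw [N_zero_left]
    have h1 : 1 ≤ ρ / Real.sin ρ := by rw [le_div_iff₀ hsinρ, one_mul]; exact Real.sin_le hρ0.le
    calc ‖x‖ = 1 * ‖x‖ := (one_mul _).symm
      _ ≤ ρ / Real.sin ρ * ‖x‖ := mul_le_mul_of_nonneg_right h1 (norm_nonneg _)
  have hθ : 0 < ‖w‖ := norm_pos_iff.2 hw0
  have hsin : 0 < Real.sin ‖w‖ := Real.sin_pos_of_pos_of_lt_pi hθ (hwρ.trans_lt hρπ)
  have h := sin_mul_norm_N_le hw hx (hwρ.trans_lt hρπ)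
  have h2 : ‖N w x‖ ≤ ‖w‖ / Real.sin ‖w‖ * ‖x‖ := by
    rw [div_mul_eq_mul_div, le_div_iff₀ hsin, mul_comm]; exact h
  refine h2.trans (mul_le_mul_of_nonneg_right ?_ (norm_nonneg _))
  -- `θ/sin θ ≤ ρ/sin ρ` from `sin ρ/ρ ≤ sin θ/θ`
  have hmono := N08HaarCompatibilityGuardJacobian.sin_div_le_sin_div hθ hwρ hρπ.le
  rw [div_le_div_iff₀ hsin hsinρ]
  rw [div_le_div_iff₀ hρ0 hθ] at hmono
  linarith

/-- THE EXPONENTIAL DOES NOT EXPAND along imaginary directions at imaginary points: `‖D exp(w) h‖ ≤ ‖h‖` for imaginary `w, h`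
(`D exp(w) h_∥ = h_∥ e^w`, `D exp(w) h_⊥ = sinc‖w‖ · h_⊥`, the two images orthogonal). [folklore] -/
theorem norm_fderiv_exp_apply_le {w h : ℍ} (hw : w.re = 0) (hh : h.re = 0) : ‖fderiv ℝ exp w h‖ ≤ ‖h‖ := by
  set p := perp w h with hp_def
  set q := par w h with hq_def
  have hp_re : p.re = 0 := perp_re hw hh
  have hqp : h = q + p := (par_add_perp w h).symm
  have hcomm : Commute w q := by rw [hq_def, par]; exact (Commute.refl w).smul_right _
  have hDq : fderiv ℝ exp w q = q * exp w := fderiv_exp_apply_of_commute hcomm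
  have hDp : fderiv ℝ exp w p = Real.sinc ‖w‖ • p := fderiv_exp_apply_of_inner_eq_zero hw hp_re (by rw [hp_def]; exact inner_perp w h)
  have hD : fderiv ℝ exp w h = q * exp w + Real.sinc ‖w‖ • p := by rw [hqp, map_add, hDq, hDp]
  -- the cross term vanishes: `q e^w = c (cos θ · w + (sin θ/θ) · w²)`, `w ⊥ p`, `w² ∈ ℝ ⊥ p`
  have hcross : ⟪q * exp w, p⟫ = 0 := by
    have hwp : ⟪w, p⟫ = 0 := by rw [hp_def]; exact inner_perp w h
    have hww : ⟪w * w, p⟫ = 0 := by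
      have e : w * w = -((Quaternion.normSq w : ℝ) : ℍ) := by rw [← sq]; exact Quaternion.sq_eq_neg_normSq.2 hw
      rw [e, inner_neg_left, Quaternion.inner_def, Quaternion.coe_mul_eq_smul, Quaternion.re_smul, Quaternion.re_star, hp_re, smul_zero, neg_zero]
    rw [hq_def, par, Quaternion.exp_of_re_eq_zero w hw, smul_mul_assoc, mul_add, Quaternion.mul_coe_eq_smul, mul_smul_comm,
      real_inner_smul_left, inner_add_left, real_inner_smul_left, real_inner_smul_left, hwp, hww, mul_zero, mul_zero, add_zero,
      mul_zero]
  have hqp0 : ⟪q, p⟫ = 0 := by rw [hq_def, par, real_inner_smul_left, hp_def, inner_perp, mul_zero]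
  have hsq : ‖fderiv ℝ exp w h‖ ^ 2 ≤ ‖h‖ ^ 2 := by
    rw [hD, norm_add_sq_real, inner_smul_right, hcross, mul_zero, mul_zero, add_zero, norm_mul, norm_exp_of_re_eq_zero hw, mul_one,
      norm_smul, mul_pow, Real.norm_eq_abs, sq_abs, hqp, norm_add_sq_real, hqp0, mul_zero, add_zero]
    have hs : Real.sinc ‖w‖ ^ 2 ≤ 1 := by
      have := Real.abs_sinc_le_one ‖w‖
      rw [← sq_abs]; exact pow_le_one₀ (abs_nonneg _) this
    nlinarith [sq_nonneg ‖p‖]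
  exact (pow_le_pow_iff_left₀ (norm_nonneg _) (norm_nonneg _) two_ne_zero).1 hsq


/-- THE EXPONENTIAL IS 1-LIPSCHITZ ON THE IMAGINARY QUATERNIONS (for the Euclidean norms): `‖e^a − e^b‖ ≤ ‖a − b‖` for imaginary `a, b`
(mean-value inequality along the imaginary segment + `norm_fderiv_exp_apply_le`). [folklore] -/
theorem norm_exp_sub_exp_le {a b : ℍ} (ha : a.re = 0) (hb : b.re = 0) : ‖exp a - exp b‖ ≤ ‖a - b‖ := by
  have hd : ∀ t : ℝ, HasDerivAt (fun t : ℝ => exp (b + t • (a - b))) (fderiv ℝ exp (b + t • (a - b)) (a - b)) t := by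
    intro t
    have hl : HasDerivAt (fun t : ℝ => b + t • (a - b)) (a - b) t := by
      simpa using ((hasDerivAt_id t).smul_const (a - b)).const_add b
    exact (hasFDerivAt_exp (b + t • (a - b))).comp_hasDerivAt t hl
  have h := norm_image_sub_le_of_norm_deriv_le_segment_01' (f := fun t : ℝ => exp (b + t • (a - b)))
    (fun t _ => (hd t).hasDerivWithinAt) (fun t _ => norm_fderiv_exp_apply_le (by simp [ha, hb]) (by simp [ha, hb]))
  simpa using h

/-- The geodesic through `1` in closed form: `e^{t x} = cos(t‖x‖) + (sin(t‖x‖)∕‖x‖)·x` for imaginary `x` and `t ≥ 0`. [folklore] -/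
theorem exp_smul_of_re_eq_zero {x : ℍ} (hx : x.re = 0) {t : ℝ} (ht : 0 ≤ t) :
    exp (t • x) = ↑(Real.cos (t * ‖x‖)) + (Real.sin (t * ‖x‖) / ‖x‖) • x := by
  have htx : (t • x).re = 0 := by simp [hx]
  rw [Quaternion.exp_of_re_eq_zero _ htx, norm_smul, Real.norm_of_nonneg ht, smul_smul]
  rcases eq_or_lt_of_le ht with rfl | ht0
  · simp
  rcases eq_or_ne x 0 with rfl | hx0
  · simp
  congr 1
  have hx' : ‖x‖ ≠ 0 := norm_ne_zero_iff.2 hx0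
  field_simp

/-- `⟨u p, u q⟩ = ⟨p, q⟩` for a unit `u` (left multiplication is an isometry). [folklore] -/
theorem inner_mul_left_mul_left {u : ℍ} (hu : ‖u‖ = 1) (p q : ℍ) : ⟪u * p, u * q⟫ = ⟪p, q⟫ := by
  have rmc : ∀ a b : ℍ, (a * b).re = (b * a).re := fun a b => by simp only [Quaternion.re_mul]; ring
  have hsu : star u * u = 1 := by rw [Quaternion.star_mul_self, Quaternion.normSq_eq_norm_mul_self, hu]; simp
  rw [Quaternion.inner_def, Quaternion.inner_def, star_mul, ← mul_assoc, rmc, ← mul_assoc, ← mul_assoc, hsu, one_mul]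

/-- THE SLERP IDENTITY: `sin θ · (A cos(tθ) + B sin(tθ)) = A sin((1−t)θ) + (A cos θ + B sin θ) sin(tθ)`. [folklore] -/
theorem slerp_identity (A B θ t : ℝ) :
    Real.sin θ * (A * Real.cos (t * θ) + B * Real.sin (t * θ)) =
      A * Real.sin ((1 - t) * θ) + (A * Real.cos θ + B * Real.sin θ) * Real.sin (t * θ) := by
  rw [show (1 - t) * θ = θ - t * θ by ring, Real.sin_sub]
  ring

/-- A sinusoid `g(t) = A cos(tθ) + B sin(tθ)` with `0 < θ < π` and `g(0), g(1) ≥ m ≥ 0` stays `≥ m` on `[0, 1]` (slerp identity and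
`sin a + sin b ≥ sin(a + b)` on `[0, π]`). [folklore] -/
theorem sinusoid_ge_of_endpoints {A B θ m t : ℝ} (hθ0 : 0 < θ) (hθπ : θ < Real.pi) (hm : 0 ≤ m) (h0 : m ≤ A)
    (h1 : m ≤ A * Real.cos θ + B * Real.sin θ) (ht0 : 0 ≤ t) (ht1 : t ≤ 1) : m ≤ A * Real.cos (t * θ) + B * Real.sin (t * θ) := by
  have hsin : 0 < Real.sin θ := Real.sin_pos_of_pos_of_lt_pi hθ0 hθπ
  have hsa : 0 ≤ Real.sin ((1 - t) * θ) :=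
    Real.sin_nonneg_of_nonneg_of_le_pi (by nlinarith) (by nlinarith [hθπ.le])
  have hsb : 0 ≤ Real.sin (t * θ) := Real.sin_nonneg_of_nonneg_of_le_pi (by positivity) (by nlinarith [hθπ.le])
  have hsum : Real.sin θ ≤ Real.sin ((1 - t) * θ) + Real.sin (t * θ) := by
    have h := Real.sin_add ((1 - t) * θ) (t * θ)
    rw [show (1 - t) * θ + t * θ = θ by ring] at h
    rw [h]
    nlinarith [Real.cos_le_one ((1 - t) * θ), Real.cos_le_one (t * θ)]
  have key := slerp_identity A B θ t
  have h2 : Real.sin θ * m ≤ Real.sin θ * (A * Real.cos (t * θ) + B * Real.sin (t * θ)) := by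
    rw [key]
    calc Real.sin θ * m ≤ (Real.sin ((1 - t) * θ) + Real.sin (t * θ)) * m := mul_le_mul_of_nonneg_right hsum hm
      _ = m * Real.sin ((1 - t) * θ) + m * Real.sin (t * θ) := by ring
      _ ≤ A * Real.sin ((1 - t) * θ) + (A * Real.cos θ + B * Real.sin θ) * Real.sin (t * θ) :=
          add_le_add (mul_le_mul_of_nonneg_right h0 hsa) (mul_le_mul_of_nonneg_right h1 hsb)
  exact le_of_mul_le_mul_left h2 hsin

/-- GEODESIC CONVEXITY OF CHORDAL BALLS ON `S³`: for unit `a, u`, imaginary `x` with `0 < ‖x‖ < π`, and `t ∈ [0, 1]`: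
`‖a − u e^{tx}‖ ≤ max ‖a − u‖ ‖a − u eˣ‖` provided both chords are `≤ √2` (`⟨a, u e^{tx}⟩` is a sinusoid in `t`). [folklore] -/
theorem norm_sub_mul_exp_smul_le {a u x : ℍ} (hu : ‖u‖ = 1) (hx : x.re = 0) (hx0 : x ≠ 0) (hxπ : ‖x‖ < Real.pi)
    (h0 : 0 ≤ ⟪a, u⟫) (h1 : 0 ≤ ⟪a, u * exp x⟫) {t : ℝ} (ht0 : 0 ≤ t) (ht1 : t ≤ 1) :
    min ⟪a, u⟫ ⟪a, u * exp x⟫ ≤ ⟪a, u * exp (t • x)⟫ := by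
  set b := star u * a with hb_def
  set θ := ‖x‖ with hθ_def
  have hθ0 : 0 < θ := norm_pos_iff.2 hx0
  have hus : u * star u = 1 := by rw [Quaternion.self_mul_star, Quaternion.normSq_eq_norm_mul_self, hu]; simp
  have hab : a = u * b := by rw [hb_def, ← mul_assoc, hus, one_mul]
  -- `⟨a, u q⟩ = ⟨b, q⟩`
  have hred : ∀ q : ℍ, ⟪a, u * q⟫ = ⟪b, q⟫ := fun q => by rw [hab, inner_mul_left_mul_left hu]
  -- the sinusoid
  have hg : ∀ s : ℝ, 0 ≤ s → ⟪b, exp (s • x)⟫ = b.re * Real.cos (s * θ) + ⟪b, x⟫ / θ * Real.sin (s * θ) := by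
    intro s hs
    have icr : ∀ (q : ℍ) (r : ℝ), ⟪q, (r : ℍ)⟫ = q.re * r := fun q r => by
      rw [real_inner_comm, Quaternion.inner_def, Quaternion.coe_mul_eq_smul, Quaternion.re_smul, Quaternion.re_star, smul_eq_mul, mul_comm]
    rw [exp_smul_of_re_eq_zero hx hs, inner_add_right, inner_smul_right, icr, ← hθ_def]
    ring
  have hg0 : ⟪a, u⟫ = b.re := by
    have := hred 1
    rw [mul_one] at this
    rw [this, ← NormedSpace.exp_zero (𝔸 := ℍ), ← zero_smul ℝ x, hg 0 le_rfl]
    simp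
  have hg1 : ⟪a, u * exp x⟫ = b.re * Real.cos θ + ⟪b, x⟫ / θ * Real.sin θ := by
    rw [hred, ← one_smul ℝ x, hg 1 zero_le_one, one_smul, one_mul]
  rw [hred (exp (t • x)), hg t ht0, hg0, hg1]
  rw [hg0] at h0
  rw [hg1] at h1
  exact sinusoid_ge_of_endpoints hθ0 hxπ (le_min h0 h1) (min_le_left _ _) (min_le_right _ _) ht0 ht1

/-- Chordal form: `‖a − u e^{tx}‖ < δ` for `t ∈ [0,1]` if `‖a − u‖ < δ`, `‖a − u eˣ‖ < δ`, `δ ≤ 1` (unit `a, u`; imaginary `x`, `‖x‖ < π`).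
Hence the guard set `{u : ∀ i, ‖aᵢ − u‖ < δ}` is geodesically convex. [folklore] -/
theorem norm_sub_mul_exp_smul_lt {a u x : ℍ} {δ : ℝ} (ha : ‖a‖ = 1) (hu : ‖u‖ = 1) (hx : x.re = 0) (hxπ : ‖x‖ < Real.pi)
    (hδ : δ ≤ 1) (h0 : ‖a - u‖ < δ) (h1 : ‖a - u * exp x‖ < δ) {t : ℝ} (ht0 : 0 ≤ t) (ht1 : t ≤ 1) :
    ‖a - u * exp (t • x)‖ < δ := by
  rcases eq_or_ne x 0 with rfl | hx0
  · simpa using h0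
  have hn : ∀ q : ℍ, q.re = 0 → ‖u * exp q‖ = 1 := fun q hq => by rw [norm_mul, hu, norm_exp_of_re_eq_zero hq, mul_one]
  -- chords² = 2 − 2⟨·,·⟩
  have hsq : ∀ v : ℍ, ‖v‖ = 1 → ‖a - v‖ ^ 2 = 2 - 2 * ⟪a, v⟫ := fun v hv => by
    rw [norm_sub_sq_real, ha, hv]; ring
  have hδ0 : 0 < δ := (norm_nonneg _).trans_lt h0
  have hsq0 : ‖a - u‖ ^ 2 < δ ^ 2 := pow_lt_pow_left₀ h0 (norm_nonneg _) two_ne_zero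
  have hsq1 : ‖a - u * exp x‖ ^ 2 < δ ^ 2 := pow_lt_pow_left₀ h1 (norm_nonneg _) two_ne_zero
  have hδ2 : δ ^ 2 ≤ 1 := pow_le_one₀ hδ0.le hδ
  have hin0 : 0 ≤ ⟪a, u⟫ := by nlinarith [hsq u hu]
  have hin1 : 0 ≤ ⟪a, u * exp x⟫ := by nlinarith [hsq _ (hn x hx)]
  have hmin := norm_sub_mul_exp_smul_le hu hx hx0 hxπ hin0 hin1 ht0 ht1
  have htx : (t • x).re = 0 := by simp [hx]
  have hlt : ‖a - u * exp (t • x)‖ ^ 2 < δ ^ 2 := by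
    rw [hsq _ (hn _ htx)]
    rcases min_choice ⟪a, u⟫ ⟪a, u * exp x⟫ with hc | hc
    · rw [hc] at hmin
      nlinarith [hsq u hu]
    · rw [hc] at hmin
      nlinarith [hsq _ (hn x hx)]
  exact (pow_lt_pow_iff_left₀ (norm_nonneg _) hδ0.le two_ne_zero).1 hlt

end Trig


end Summit.QuantumFields.YangMills.BalabanUVNodes.N08HaarCompatibilityGuardGeodesics

end
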